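import Literature.NumberTheory.GaloisCohomology.Howard2004.KolyvaginSystemRescalingProofs
import Literature.NumberTheory.GaloisRepresentations.BrauerTower
import HarnessLib

/-!
# Howard 2004, Def. 1.1.1 / 1.2.2: the transverse condition is an `R`-submodule; discharge of the
# scalar hypotheses of the Kolyvagin-system rescaling from H

Topic `NumberTheory/GaloisCohomology/Howard2004`; theorems only (no definition, no named fact, no
`sorry`).  Sequel to `KolyvaginSystemScalars` / `KolyvaginSystemRescalingProofs` (cell
`pub/bsd-print-x9`, x9-p1 LEAD ruling 2026-08-28 «(n2)»): the two hypotheses those files keep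
explicit — «the level Selmer groups `H¹_{F(n)}(K, T^{(k)}/I_n)` are `R_k`-submodules»
(`LevelData.IsSelmerScalarStable`) and «the slot is natural along the scalars on the finite classes»
(`LevelData.FsScalarNaturalAt`) — FOLLOW from `DVRSetting.SatisfiesH` (Howard's H.0–H.5 with the
pinned slot):

* `resSubgroup_hom_scalarMapH1_eq_zero` — restriction to a subgroup `H ≤ Γ_K` commutes with the
  scalars `H¹(r•)` (kernel form; both composites are the map of the compatible pair `(H ↪ Γ_K, r•)`,
  tree `map_comp_apply_of`);
* `scalarMapH1_mem_transverseCondition`, `isScalarStable_transverseStructure` — Howard's transverse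
  condition `H¹_tr(K_λ, T) = ker (H¹(K_λ, T) → H¹(L, T))` (§1.2) is an `R`-submodule, so the
  structures `F(n) = F^∅_∅(n)` keep `R`-submodule conditions (Def. 1.1.1 asks exactly this of a
  local condition);
* `SelmerStructure.IsScalarStable.of_surjective_algebraMap` — an `R`-stable structure on an
  `R_k`-module is `R_k`-stable when `R → R_k` is onto;
* `DVRSetting.SatisfiesH.isScalarStable_cond` (T4 `cond_smul`), **`.isSelmerScalarStable`**
  (`hst` of the rescaling theorems) and **`.fsScalarNaturalAt`** (`hnat`, from `fs_admissible`).

BSD is not proved by any of this.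

References: B. Howard, *The Heegner point Kolyvagin system*, Compositio Math. 140 (2004), Def. 1.1.1,
§1.2, Def. 1.2.2 (arXiv:1202.6340 pp. 5–6); J.-P. Serre, *Galois Cohomology* (1997), I §2.4.
-/

set_option autoImplicit false

noncomputable section

open Function NumberField IsDedekindDomain Field
open scoped NumberField ContRepresentation Classical TensorProduct

namespace Literature.NumberTheory.GaloisCohomology.Howard2004

open Literature.NumberTheory.GaloisRepresentations
open Literature.NumberTheory.GaloisRepresentations.DiscreteGaloisModule
open Literature.NumberTheory.GaloisRepresentations.galoisCohomology

/-! ## Restriction to a subgroup commutes with the scalars -/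

section ResScalar

variable {K : Type} [Field K] {M : Type} [AddCommGroup M] [TopologicalSpace M] [DiscreteTopology M]
  {R : Type} [CommRing R] [Module R M] {ρ : DiscreteGaloisModule K M}

/-- **Restriction to a subgroup commutes with the scalars** (kernel form): if `res_H c = 0` then
`res_H (H¹(r•) c) = 0` — both `res_H ∘ H¹(r•)` and `H¹_H(r•) ∘ res_H` are the map induced by the
compatible pair `(H ↪ Γ_K, r•)`. [cite: SerreGaloisCohomology1997, I §2.4] -/
theorem resSubgroup_hom_scalarMapH1_eq_zero (hρ : ρ.IsScalarLinear R)
    (H : Subgroup (absoluteGaloisGroup K)) (r : R) {c : galoisCohomology ρ 1}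
    (hc : (resSubgroup ρ.toTopRep H 1).hom c = 0) :
    (resSubgroup ρ.toTopRep H 1).hom (scalarMapH1 ρ hρ r c) = 0 := by
  -- `r•` as a morphism `X|_{res subtype} ⟶ X|H` and as an endomorphism of `X|H`
  let hH : TopRep.res ((subgroupSubtypeHom H : H →ₜ* absoluteGaloisGroup K) :
      H →* absoluteGaloisGroup K) ρ.toTopRep ⟶ subgroupRep ρ.toTopRep H :=
    TopRep.ofHom ⟨⟨(DistribSMul.toAddMonoidHom M r).toIntLinearMap, continuous_of_discreteTopology⟩,
      fun g => ContinuousLinearMap.ext fun x => (hρ (g : absoluteGaloisGroup K) r x).symm⟩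
  let sH : TopRep.res ((ContinuousMonoidHom.id H : H →ₜ* H) : H →* H) (subgroupRep ρ.toTopRep H) ⟶
      subgroupRep ρ.toTopRep H :=
    TopRep.ofHom ⟨⟨(DistribSMul.toAddMonoidHom M r).toIntLinearMap, continuous_of_discreteTopology⟩,
      fun g => ContinuousLinearMap.ext fun x => (hρ (g : absoluteGaloisGroup K) r x).symm⟩
  have e1 : (resSubgroup ρ.toTopRep H 1).hom (scalarMapH1 ρ hρ r c) =
      (ContinuousCohomology.map (subgroupSubtypeHom H) hH 1).hom c :=
    (map_comp_apply_of (X := ρ.toTopRep) (Y := ρ.toTopRep) (Z := subgroupRep ρ.toTopRep H)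
      (ContinuousMonoidHom.id _) (subgroupSubtypeHom H) (subgroupSubtypeHom H) (fun _ => rfl)
      (TopRep.ofHom ⟨(scalarIntertwining ρ hρ r).toContinuousLinearMap,
        (scalarIntertwining ρ hρ r).isIntertwining'⟩)
      (TopRep.ofHom ⟨ContinuousLinearMap.id ℤ M, fun _ => rfl⟩) hH (fun _ => rfl) 1 c).symm
  have e2 : (ContinuousCohomology.map (ContinuousMonoidHom.id H) sH 1).hom
        ((resSubgroup ρ.toTopRep H 1).hom c) =
      (ContinuousCohomology.map (subgroupSubtypeHom H) hH 1).hom c :=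
    (map_comp_apply_of (X := ρ.toTopRep) (Y := subgroupRep ρ.toTopRep H)
      (Z := subgroupRep ρ.toTopRep H) (subgroupSubtypeHom H) (ContinuousMonoidHom.id H)
      (subgroupSubtypeHom H) (fun _ => rfl) (TopRep.ofHom ⟨ContinuousLinearMap.id ℤ M, fun _ => rfl⟩)
      sH hH (fun _ => rfl) 1 c).symm
  rw [e1, ← e2, hc, map_zero]

end ResScalar

section Transverse

variable {K : Type} [Field K] [NumberField K] {M : Type} [AddCommGroup M] [TopologicalSpace M]
  [DiscreteTopology M] {R : Type} [CommRing R] [Module R M] {ρ : DiscreteGaloisModule K M}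

/-- **Howard's transverse condition `H¹_tr(K_λ, T) = ker (H¹(K_λ, T) → H¹(L, T))` is an
`R`-submodule** (stable under every `H¹(r•)`), as Def. 1.1.1 requires of a local condition.
[cite: Howard2004HeegnerKolyvagin, Def. 1.1.1 and §1.2 (arXiv p. 5 L52–56, p. 6 L84–95)] -/
theorem scalarMapH1_mem_transverseCondition (p : ℕ) [Fact p.Prime] (hρ : ρ.IsScalarLinear R)
    (ℓ : ℕ) (jbar : AlgebraicClosure K →+* ℂ) (v : HeightOneSpectrum (𝓞 K)) (r : R)
    {c : galoisCohomology (ρ.toLocal (Sum.inr v)) 1} (hc : c ∈ transverseCondition p ρ ℓ jbar v) :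
    scalarMapH1 (ρ.toLocal (Sum.inr v)) (hρ.restrictField (Place.Completion (Sum.inr v))) r c ∈
      transverseCondition p ρ ℓ jbar v :=
  resSubgroup_hom_scalarMapH1_eq_zero (ρ := GaloisRep.toLocal v ρ) (hρ.restrictField _)
    (transverseFixer p ℓ jbar v) r hc

/-- **Howard's transverse structure is scalar-stable** (`⊥` at the infinite places, `H¹_tr` at the
finite ones). [cite: Howard2004HeegnerKolyvagin, Def. 1.2.2 (arXiv Def. 2.2.2, p. 6)] -/
theorem isScalarStable_transverseStructure (p : ℕ) [Fact p.Prime] (hρ : ρ.IsScalarLinear R)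
    (jbar : AlgebraicClosure K →+* ℂ) : (transverseStructure p ρ jbar).IsScalarStable hρ := by
  intro w r x hx
  rcases w with w | v
  · change x ∈ (⊥ : AddSubgroup _) at hx
    rw [AddSubgroup.mem_bot] at hx
    subst hx
    rw [map_zero]
    exact AddSubgroup.zero_mem _
  · exact scalarMapH1_mem_transverseCondition p hρ _ jbar v r hx

/-- Scalar-stability descends along a surjective `R → A`: an `R`-stable structure on an `A`-linear
module (`A = R_k = R/𝔪^{e_k}`) is `A`-stable. [cite: Howard2004HeegnerKolyvagin, Def. 1.1.1 and §1.6 (arXiv p. 5 L20–21, p. 11 L13–16)] -/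
theorem _root_.Literature.NumberTheory.GaloisRepresentations.DiscreteGaloisModule.SelmerStructure.IsScalarStable.of_surjective_algebraMap
    {A : Type} [CommRing A] [Algebra R A] [Module A M] [IsScalarTower R A M]
    (hA : ρ.IsScalarLinear A) {F : SelmerStructure ρ}
    (hF : F.IsScalarStable (hA.of_isScalarTower (R := R)))
    (hsurj : Function.Surjective (algebraMap R A)) : F.IsScalarStable hA := by
  intro v a x hx
  obtain ⟨r, rfl⟩ := hsurj a
  rw [scalarMapH1_algebraMap]
  exact hF v r hx

end Transverse

section DVRDischarge

variable {p : ℕ} [Fact p.Prime] {K : Type} [Field K] [NumberField K]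
  {R : Type} [CommRing R] [IsDomain R] [IsDiscreteValuationRing R] [Algebra ℤ_[p] R]
  {N : ℕ → Type} [∀ k, AddCommGroup (N k)] [∀ k, TopologicalSpace (N k)]
  [∀ k, DiscreteTopology (N k)] [∀ k, Module R (N k)]
  {Rk : ℕ → Type} [∀ k, CommRing (Rk k)] [∀ k, IsLocalRing (Rk k)] [∀ k, TopologicalSpace (Rk k)]
  [∀ k, DiscreteTopology (Rk k)] [∀ k, Algebra ℤ_[p] (Rk k)] [∀ k, Algebra R (Rk k)]
  [∀ k, Module (Rk k) (N k)] [∀ k, IsScalarTower R (Rk k) (N k)]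
  {Nbar : Type} [AddCommGroup Nbar] [TopologicalSpace Nbar] [DiscreteTopology Nbar]
  [∀ k, Module (Rk k) Nbar]
  {Nq : ℕ → Finset (HeightOneSpectrum (𝓞 K)) → Type} [∀ k n, AddCommGroup (Nq k n)]
  [∀ k n, TopologicalSpace (Nq k n)] [∀ k n, DiscreteTopology (Nq k n)]
  [∀ k n, Module (Rk k) (Nq k n)] [∀ k n, Module R (Nq k n)]
  [∀ k n, IsScalarTower R (Rk k) (Nq k n)]

namespace DVRSetting.SatisfiesH

/-- Under H (T4, `cond_smul` with `algebraMap R R_k` onto), the conditions of `F` on level `k` are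
`R_k`-submodules. [cite: Howard2004HeegnerKolyvagin, Def. 1.1.1 and §1.6 (arXiv p. 5 L20–21, p. 11 L13–16)] -/
theorem isScalarStable_cond {S : DVRSetting p K R N Rk Nbar Nq} (hy : S.SatisfiesH) (k : ℕ) :
    (S.t k).cond.IsScalarStable (hy.scalarLinear k) := by
  refine SelmerStructure.IsScalarStable.of_surjective_algebraMap (R := R) (hy.scalarLinear k) ?_
    (hy.algebraMap_surjective k)
  intro v r x hx
  exact hy.cond_smul k v r ⟨x, hx, rfl⟩

/-- **Under H the level Selmer groups `H¹_{F(n)}(K, T^{(k)}/I_n)` are `R_k`-submodules** (the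
hypothesis `IsSelmerScalarStable` of the rescaling theorems, discharged).
[cite: Howard2004HeegnerKolyvagin, Def. 1.1.10 and Def. 1.2.2–1.2.3 (arXiv p. 6)] -/
theorem isSelmerScalarStable {S : DVRSetting p K R N Rk Nbar Nq} (hy : S.SatisfiesH) (k : ℕ) :
    (S.LD k).IsSelmerScalarStable S.jbar (hy.scalarLinear k) :=
  (S.LD k).isSelmerScalarStable_of_cond S.jbar (hy.scalarLinear k) (hy.isScalarStable_cond k)
    (isScalarStable_transverseStructure p (hy.scalarLinear k) S.jbar)

/-- **Under H the slots are natural along the scalars on the finite classes** at every `(nℓ, ℓ)`,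
`nℓ ∈ 𝓝(𝓛)` (from the pin `fs_admissible`; the hypothesis `hnat` of the rescaling theorems,
discharged). [cite: Howard2004HeegnerKolyvagin, Def. 1.1.8 (arXiv p. 5, L126–131)] -/
theorem fsScalarNaturalAt {S : DVRSetting p K R N Rk Nbar Nq} (hy : S.SatisfiesH) (k : ℕ)
    (n : Finset (HeightOneSpectrum (𝓞 K))) (v : HeightOneSpectrum (𝓞 K))
    (hn : insert v n ∈ (S.t k).levelSet) :
    (S.LD k).FsScalarNaturalAt (hy.scalarLinear k) (insert v n) v :=
  ((hy.fs_admissible k).fsNaturalAt hn hn (Finset.mem_insert_self v n)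
    (Finset.mem_insert_self v n)).fsScalarNaturalAt (hy.scalarLinear k)

end DVRSetting.SatisfiesH

end DVRDischarge

end Literature.NumberTheory.GaloisCohomology.Howard2004

end
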